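import Summits.CriticalPhenomena.PercolationContinuityZ3.Theorems.PercNearOneGluingNoHeavyLowerTailChampionStability
import Summits.CriticalPhenomena.PercolationContinuityZ3.Theorems.PercNearOneGluingAdditiveGluingOneBond
import Literature.Probability.Percolation.LonelyClusterExchange
import HarnessLib

/-!
# `NoHeavyLowerTail` (stmt-CriticalPhenomena-4575) — set-champion stability survives DELETING A PORT-EDGE of the observer set
# whose relay endpoint is currently dominated by the witness ("port-elimination step")

Support file (prover `prim-lf-3`, lemma factory #3; `--supports stmt-CriticalPhenomena-4575`).  No definitions, no named facts,
no sorries.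

Notation: `μ_w = prodBernoulli w` on `Fin n`, relays `A`, level `j`, `π(v) = {z ∈ A : v ↔ z}`, lightness `I_w(v) = μ_w{|π(v)| ≤ j}`;
for a finite observer SET `O` and a witness `c`, `π(O) = {z ∈ A : ∃ x ∈ O, x ↔ z}` and the SET-CHAMPION-STABILITY inequality
  `CS_w(O, c) :  μ_w(c ↮ O, 1 ≤ |π(O)| ≤ j) ≤ μ_w(c ↮ O, |π(c)| ≤ j)`
(the form of `Literature…observerSet_le_of_lonelier`, of `CutObserver.bad_le_glued_iff_setCS`, and of the two-pendant-stars inequality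
TPS of `TwoPendantStars.cil_twoPendantStars_of_TPS`: `c` is a valid CIL witness for the observer obtained by gluing `O`).

**Theorem (`setCS_of_portDeletion_one`).**  Let `x ∈ O`, `a ≠ x`, `e = s(a, x)`.  If `I_{w[e↦1]}(a) ≤ I_{w[e↦1]}(c)` (the endpoint `a` is
dominated by the witness once `e` is glued — implied by domination at the current weights or after deletion, `CutObserver.lightness_raise_le`) and `CS_{w[e ↦ 0]}(O, c)` holds (the inequality after deleting the pair `e`), then `CS_w(O, c)` holds.
No hypothesis on `O`, `A`, the graph, or on `c` being a champion.

Proof: both sides of `CS` are affine in the weight of `e` (`stub_oneBondDecomp_k15`); at weight `0` this is the hypothesis; at weight `1`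
the member `x` of `O` is glued to `a`, so `I_{w[e↦1]}(x) = I_{w[e↦1]}(a)` (`ChampionStability.real_update_one_eq`), the domination
`I(a) ≤ I(c)` survives raising a pair AT `a` (`CutObserver.lightness_raise_le`, van den Berg–Häggström–Kahn 2006 Thm 1.5 underneath), and
`CS_{w[e↦1]}(O, c)` is the observer-set transfer `observerSet_le_of_lonelier` with the member `x` no lonelier than `c`.

**Theorem (`setCS_of_portDeletion_glued_one`).**  Same conclusion from domination in the GLUED reference: if
`J_{w[e↦1]}(O, a) ≤ J_{w[e↦1]}(O, c)` where `J_u(O, v) = μ_u(v ↮ O, |π(v)| ≤ j) + μ_u(v ↔ O, |π(O)| ≤ j)` is the lightness of `v` with `O`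
glued, and `CS_{w[e↦0]}(O, c)`, then `CS_w(O, c)` (first-open-coin split: at weight `1`, `J(O, a) = μ{|π(O)| ≤ j}`).

Role (crux memo LF3 CANDIDATES.md §PEC, item evidence): this is the generic STEP of the port-elimination certificates for the relay-neighboured
pair atom RN-CS(2) = TPS: starting from `c = champ(K)` one may delete, one at a time, coins of the two stars whose port is currently dominated by
`c`, and it suffices to establish `CS` in the reduced graph (where a port theorem applies).  The step with `O = {y}` a single observer and `c` a
champion of `w[e ↦ 0]` is `cil_witness_of_portAddition`; here the domination hypothesis is taken at `w` (weaker, by `lightness_raise_le`) and the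
observer is a set.
-/

noncomputable section

namespace Summit.CriticalPhenomena.PercolationContinuityZ3.Theorems

open MeasureTheory Set Literature.Probability.LatticeModels Literature.Probability.Percolation
open scoped Classical BigOperators

variable {n : ℕ}

namespace PortElimination

/-- Under `w[s(a,x) ↦ 1]` (from a weight function vanishing at `s(a,x)`) the lightness of `x` equals the lightness of `a`:
the two vertices are almost surely joined. [folklore] -/
theorem lightness_update_one_eq (w₀ : Sym2 (Fin n) → unitInterval) (A : Finset (Fin n)) (a x : Fin n) (j : ℕ)
    (hax : a ≠ x) (hw : w₀ s(a, x) = 0) :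
    (prodBernoulli (Function.update w₀ s(a, x) 1)).real
        {ω : BondConfig (Fin n) | (A.filter fun z => ω ∈ openConn x z).card ≤ j} =
      (prodBernoulli (Function.update w₀ s(a, x) 1)).real
        {ω : BondConfig (Fin n) | (A.filter fun z => ω ∈ openConn a z).card ≤ j} := by
  rw [ChampionStability.real_update_one_eq w₀ hw, ChampionStability.real_update_one_eq w₀ hw]
  congr 1
  ext ω
  simp only [Set.mem_preimage, Set.mem_setOf_eq]
  have hadj : (openGraph (insert s(a, x) ω)).Reachable a x :=
    SimpleGraph.Adj.reachable ((openGraph_adj _ a x).2 ⟨Set.mem_insert _ _, hax⟩)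
  have hfilt : (A.filter fun z => insert s(a, x) ω ∈ openConn x z) =
      (A.filter fun z => insert s(a, x) ω ∈ openConn a z) := by
    apply Finset.filter_congr
    intro z _
    simp only [openConn, Set.mem_setOf_eq]
    exact ⟨fun h => hadj.trans h, fun h => hadj.symm.trans h⟩
  rw [hfilt]

/-- **Port-elimination step for set-champion stability (domination at the glued end).**  `x ∈ O`, `a ≠ x`, `e = s(a, x)`;
if `I_{w[e↦1]}(a) ≤ I_{w[e↦1]}(c)` (the endpoint `a` is dominated by the witness once the pair is glued) and `CS_{w[e↦0]}(O, c)` holds, then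
`CS_w(O, c)`:  `μ_w(c ↮ O, 1 ≤ |π(O)| ≤ j) ≤ μ_w(c ↮ O, |π(c)| ≤ j)`.  The domination hypothesis at weight `1` is implied by domination at
any smaller weight of `e` (`CutObserver.lightness_raise_le`), in particular at `w` itself or at `w[e↦0]`. [this file] -/
theorem setCS_of_portDeletion_one (w : Sym2 (Fin n) → unitInterval) (A O : Finset (Fin n)) (x a c : Fin n) (j : ℕ)
    (hx : x ∈ O) (hax : a ≠ x)
    (hdom : (prodBernoulli (Function.update w s(a, x) 1)).real
          {ω : BondConfig (Fin n) | (A.filter fun z => ω ∈ openConn a z).card ≤ j} ≤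
      (prodBernoulli (Function.update w s(a, x) 1)).real
          {ω : BondConfig (Fin n) | (A.filter fun z => ω ∈ openConn c z).card ≤ j})
    (hrec : (prodBernoulli (Function.update w s(a, x) 0)).real {ω : BondConfig (Fin n) |
          (∀ v ∈ O, ω ∉ openConn c v) ∧
          1 ≤ (A.filter fun z => ∃ v ∈ O, ω ∈ openConn v z).card ∧
          (A.filter fun z => ∃ v ∈ O, ω ∈ openConn v z).card ≤ j} ≤
      (prodBernoulli (Function.update w s(a, x) 0)).real {ω : BondConfig (Fin n) |
          (∀ v ∈ O, ω ∉ openConn c v) ∧ (A.filter fun z => ω ∈ openConn c z).card ≤ j}) :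
    (prodBernoulli w).real {ω : BondConfig (Fin n) | (∀ v ∈ O, ω ∉ openConn c v) ∧
        1 ≤ (A.filter fun z => ∃ v ∈ O, ω ∈ openConn v z).card ∧
        (A.filter fun z => ∃ v ∈ O, ω ∈ openConn v z).card ≤ j} ≤
      (prodBernoulli w).real {ω : BondConfig (Fin n) | (∀ v ∈ O, ω ∉ openConn c v) ∧
        (A.filter fun z => ω ∈ openConn c z).card ≤ j} := by
  set e : Sym2 (Fin n) := s(a, x) with he
  set w₀ := Function.update w e 0 with hw₀
  set w₁ := Function.update w e 1 with hw₁
  set L : Set (BondConfig (Fin n)) := {ω : BondConfig (Fin n) | (∀ v ∈ O, ω ∉ openConn c v) ∧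
    1 ≤ (A.filter fun z => ∃ v ∈ O, ω ∈ openConn v z).card ∧
    (A.filter fun z => ∃ v ∈ O, ω ∈ openConn v z).card ≤ j} with hL
  set G : Set (BondConfig (Fin n)) := {ω : BondConfig (Fin n) | (∀ v ∈ O, ω ∉ openConn c v) ∧
    (A.filter fun z => ω ∈ openConn c z).card ≤ j} with hG
  -- weight 1: `x` is glued to `a`, so `x` is no lonelier than `c`; observer-set transfer
  have h1 : (prodBernoulli w₁).real L ≤ (prodBernoulli w₁).real G := by
    have hw0e : w₀ s(a, x) = 0 := by rw [← he, hw₀, Function.update_self]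
    have hw1' : w₁ = Function.update w₀ s(a, x) 1 := by rw [hw₁, hw₀, ← he, Function.update_idem]
    have hxa : (prodBernoulli w₁).real
          {ω : BondConfig (Fin n) | (A.filter fun z => ω ∈ openConn x z).card ≤ j} =
        (prodBernoulli w₁).real
          {ω : BondConfig (Fin n) | (A.filter fun z => ω ∈ openConn a z).card ≤ j} := by
      rw [hw1']; exact lightness_update_one_eq w₀ A a x j hax hw0e
    have hle : (prodBernoulli w₁).real
          {ω : BondConfig (Fin n) | (A.filter fun z => ω ∈ openConn x z).card ≤ j} ≤
        (prodBernoulli w₁).real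
          {ω : BondConfig (Fin n) | (A.filter fun z => ω ∈ openConn c z).card ≤ j} := by
      rw [hxa, hw₁, he]; exact hdom
    have key := observerSet_le_of_lonelier w₁ A O x c hx j hle
    rw [hL, hG]
    convert key
  -- weight 0: hypothesis
  have h0 : (prodBernoulli w₀).real L ≤ (prodBernoulli w₀).real G := by rw [hw₀, he]; exact hrec
  -- affine combination
  have hp0 : 0 ≤ (w e : ℝ) := (w e).2.1
  have hp1 : (w e : ℝ) ≤ 1 := (w e).2.2
  rw [stub_oneBondDecomp_k15 n w e L, stub_oneBondDecomp_k15 n w e G]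
  have hA : (1 - (w e : ℝ)) * (prodBernoulli w₀).real L ≤ (1 - (w e : ℝ)) * (prodBernoulli w₀).real G :=
    mul_le_mul_of_nonneg_left h0 (by linarith)
  have hB : (w e : ℝ) * (prodBernoulli w₁).real L ≤ (w e : ℝ) * (prodBernoulli w₁).real G :=
    mul_le_mul_of_nonneg_left h1 hp0
  linarith

/-- **Port-elimination step, glued-reference domination.**  `x ∈ O`, `a ≠ x`, `e = s(a, x)`, `w₁ = w[e ↦ 1]`, and write
`J_u(O, v) = μ_u(v ↮ O, |π(v)| ≤ j) + μ_u(v ↔ O, |π(O)| ≤ j)` (the lightness of `v` in the graph with `O` glued, cf.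
`CutObserver.bad_le_glued_iff_setCS`).  If `J_{w₁}(O, a) ≤ J_{w₁}(O, c)` and `CS_{w[e↦0]}(O, c)` holds, then `CS_w(O, c)`.
Mechanism: at weight `1` the port `a` is a.s. joined to `O`, so `J_{w₁}(O, a) = μ_{w₁}{|π(O)| ≤ j}`, and subtracting the common mass
`μ_{w₁}(c ↔ O, |π(O)| ≤ j)` leaves `CS_{w₁}(O, c)`; then the one-bond decomposition.  (First-open-coin split of the glued observer.) [this file] -/
theorem setCS_of_portDeletion_glued_one (w : Sym2 (Fin n) → unitInterval) (A O : Finset (Fin n)) (x a c : Fin n) (j : ℕ)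
    (hx : x ∈ O) (hax : a ≠ x)
    (hdom : (prodBernoulli (Function.update w s(a, x) 1)).real {ω : BondConfig (Fin n) |
            (∀ v ∈ O, ω ∉ openConn a v) ∧ (A.filter fun z => ω ∈ openConn a z).card ≤ j} +
          (prodBernoulli (Function.update w s(a, x) 1)).real {ω : BondConfig (Fin n) |
            (∃ v ∈ O, ω ∈ openConn a v) ∧ (A.filter fun z => ∃ v ∈ O, ω ∈ openConn v z).card ≤ j} ≤
        (prodBernoulli (Function.update w s(a, x) 1)).real {ω : BondConfig (Fin n) |
            (∀ v ∈ O, ω ∉ openConn c v) ∧ (A.filter fun z => ω ∈ openConn c z).card ≤ j} +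
          (prodBernoulli (Function.update w s(a, x) 1)).real {ω : BondConfig (Fin n) |
            (∃ v ∈ O, ω ∈ openConn c v) ∧ (A.filter fun z => ∃ v ∈ O, ω ∈ openConn v z).card ≤ j})
    (hrec : (prodBernoulli (Function.update w s(a, x) 0)).real {ω : BondConfig (Fin n) |
          (∀ v ∈ O, ω ∉ openConn c v) ∧
          1 ≤ (A.filter fun z => ∃ v ∈ O, ω ∈ openConn v z).card ∧
          (A.filter fun z => ∃ v ∈ O, ω ∈ openConn v z).card ≤ j} ≤
      (prodBernoulli (Function.update w s(a, x) 0)).real {ω : BondConfig (Fin n) |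
          (∀ v ∈ O, ω ∉ openConn c v) ∧ (A.filter fun z => ω ∈ openConn c z).card ≤ j}) :
    (prodBernoulli w).real {ω : BondConfig (Fin n) | (∀ v ∈ O, ω ∉ openConn c v) ∧
        1 ≤ (A.filter fun z => ∃ v ∈ O, ω ∈ openConn v z).card ∧
        (A.filter fun z => ∃ v ∈ O, ω ∈ openConn v z).card ≤ j} ≤
      (prodBernoulli w).real {ω : BondConfig (Fin n) | (∀ v ∈ O, ω ∉ openConn c v) ∧
        (A.filter fun z => ω ∈ openConn c z).card ≤ j} := by
  set e : Sym2 (Fin n) := s(a, x) with he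
  set w₀ := Function.update w e 0 with hw₀
  set w₁ := Function.update w e 1 with hw₁
  set L : Set (BondConfig (Fin n)) := {ω : BondConfig (Fin n) | (∀ v ∈ O, ω ∉ openConn c v) ∧
    1 ≤ (A.filter fun z => ∃ v ∈ O, ω ∈ openConn v z).card ∧
    (A.filter fun z => ∃ v ∈ O, ω ∈ openConn v z).card ≤ j} with hL
  set G : Set (BondConfig (Fin n)) := {ω : BondConfig (Fin n) | (∀ v ∈ O, ω ∉ openConn c v) ∧
    (A.filter fun z => ω ∈ openConn c z).card ≤ j} with hG
  set B : Set (BondConfig (Fin n)) := {ω : BondConfig (Fin n) |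
    (A.filter fun z => ∃ v ∈ O, ω ∈ openConn v z).card ≤ j} with hB
  set X : Set (BondConfig (Fin n)) := {ω : BondConfig (Fin n) | (∀ v ∈ O, ω ∉ openConn c v) ∧
    (A.filter fun z => ∃ v ∈ O, ω ∈ openConn v z).card ≤ j} with hX
  set Yc : Set (BondConfig (Fin n)) := {ω : BondConfig (Fin n) | (∃ v ∈ O, ω ∈ openConn c v) ∧
    (A.filter fun z => ∃ v ∈ O, ω ∈ openConn v z).card ≤ j} with hYc
  set Za : Set (BondConfig (Fin n)) := {ω : BondConfig (Fin n) | (∀ v ∈ O, ω ∉ openConn a v) ∧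
    (A.filter fun z => ω ∈ openConn a z).card ≤ j} with hZa
  set Ya : Set (BondConfig (Fin n)) := {ω : BondConfig (Fin n) | (∃ v ∈ O, ω ∈ openConn a v) ∧
    (A.filter fun z => ∃ v ∈ O, ω ∈ openConn v z).card ≤ j} with hYa
  have hmeas : ∀ S : Set (BondConfig (Fin n)), MeasurableSet S := fun S => (Set.toFinite S).measurableSet
  -- weight 1
  have h1 : (prodBernoulli w₁).real L ≤ (prodBernoulli w₁).real G := by
    have hw0e : w₀ s(a, x) = 0 := by rw [← he, hw₀, Function.update_self]
    have hw1' : w₁ = Function.update w₀ s(a, x) 1 := by rw [hw₁, hw₀, ← he, Function.update_idem]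
    have hreach : ∀ ω : BondConfig (Fin n), (insert s(a, x) ω) ∈ openConn a x := by
      intro ω
      simp only [openConn, Set.mem_setOf_eq]
      exact SimpleGraph.Adj.reachable ((openGraph_adj _ a x).2 ⟨Set.mem_insert _ _, hax⟩)
    -- `a` is a.s. joined to `O` under `w₁`
    have hZa : (prodBernoulli w₁).real Za = 0 := by
      rw [hw1', ChampionStability.real_update_one_eq w₀ hw0e Za]
      have : ((fun ω : BondConfig (Fin n) => insert s(a, x) ω) ⁻¹' Za) = ∅ := by
        ext ω
        simp only [Set.mem_preimage, hZa, Set.mem_setOf_eq, Set.mem_empty_iff_false, iff_false, not_and]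
        intro h
        exact absurd (hreach ω) (h x hx)
      rw [this, measureReal_empty]
    have hYa : (prodBernoulli w₁).real Ya = (prodBernoulli w₁).real B := by
      rw [hw1', ChampionStability.real_update_one_eq w₀ hw0e Ya, ChampionStability.real_update_one_eq w₀ hw0e B]
      congr 1
      ext ω
      simp only [Set.mem_preimage, hYa, hB, Set.mem_setOf_eq]
      exact ⟨fun h => h.2, fun h => ⟨⟨x, hx, hreach ω⟩, h⟩⟩
    -- split `B` along `c ↔ O`
    have hsplit : (prodBernoulli w₁).real B = (prodBernoulli w₁).real X + (prodBernoulli w₁).real Yc := by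
      have hU : B = X ∪ Yc := by
        ext ω
        simp only [hB, hX, hYc, Set.mem_union, Set.mem_setOf_eq]
        constructor
        · intro h
          by_cases hc : ∀ v ∈ O, ω ∉ openConn c v
          · exact Or.inl ⟨hc, h⟩
          · push Not at hc
            exact Or.inr ⟨hc, h⟩
        · rintro (⟨-, h⟩ | ⟨-, h⟩) <;> exact h
      have hD : Disjoint X Yc := by
        rw [Set.disjoint_left]
        rintro ω ⟨h1, -⟩ ⟨⟨v, hv, h2⟩, -⟩
        exact h1 v hv h2
      rw [hU, measureReal_union hD (hmeas _)]
    have hdom' : (prodBernoulli w₁).real Za + (prodBernoulli w₁).real Ya ≤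
        (prodBernoulli w₁).real G + (prodBernoulli w₁).real Yc := by
      rw [hw₁, he]; exact hdom
    have hLX : (prodBernoulli w₁).real L ≤ (prodBernoulli w₁).real X :=
      measureReal_mono (fun ω hω => ⟨hω.1, hω.2.2⟩) (measure_ne_top _ _)
    rw [hZa, hYa, zero_add, hsplit] at hdom'
    linarith
  -- weight 0: hypothesis
  have h0 : (prodBernoulli w₀).real L ≤ (prodBernoulli w₀).real G := by rw [hw₀, he]; exact hrec
  -- affine combination
  have hp0 : 0 ≤ (w e : ℝ) := (w e).2.1
  have hp1 : (w e : ℝ) ≤ 1 := (w e).2.2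
  rw [stub_oneBondDecomp_k15 n w e L, stub_oneBondDecomp_k15 n w e G]
  have hA : (1 - (w e : ℝ)) * (prodBernoulli w₀).real L ≤ (1 - (w e : ℝ)) * (prodBernoulli w₀).real G :=
    mul_le_mul_of_nonneg_left h0 (by linarith)
  have hB' : (w e : ℝ) * (prodBernoulli w₁).real L ≤ (w e : ℝ) * (prodBernoulli w₁).real G :=
    mul_le_mul_of_nonneg_left h1 hp0
  linarith

end PortElimination

end Summit.CriticalPhenomena.PercolationContinuityZ3.Theorems

end
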